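import Summits.NavierStokesRegularity.NavierStokesRegularity.Theorems.TypeILiouvilleTypeIliouvilleLOseenGaugeDriftPath
import Literature.Analysis.FluidPDE.GigaMiura2011ScaledAlignmentBlowupLimitHolds
import Literature.Analysis.FluidPDE.KNSSLiouvilleBridge
import HarnessLib

/-!
# Drift regularity: smooth members of the duality-form class are accelerated Galilean images of
# bounded KNSS-mild ancient solutions (W1 ⟨stmt-NavierStokesRegularity-1222⟩ tooling)

Support file (theorems only, no definitions, no named facts). The W1 crux `PoloidalLiouville`
(routes `ThreadingFlux` / `UnthreadedDoor`) quantifies over bounded ancient mild solutions in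
DUALITY form (`IsBoundedAncientMildSolution 1 u`) which are jointly `C^∞` on the open slab
`(−∞,0) × ℝ³`. The tree's Oseen gauge theorem (`oseen_gauge_of_stronglyMeasurable`, here in the
form with the frame path exported, `oseen_gauge_driftPath_of_stronglyMeasurable`) writes every
member as `u(t) = V(t, · − ξ(t)) + c(t)` a.e., `V` a bounded continuous ancient solution of the
Oseen integral equation (print's class, KNSS 2009 §4 (i)), `ξ` continuous, `ξ(t) − ξ(s) = ∫ₛᵗ c`.

* ★ `inertialGauge_of_smooth` — **DRIFT REGULARITY.** If `u` is moreover jointly continuous and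
  `C^∞` on the slab (the W1 class), then the frame path is `C^∞` on `t < 0` and the representation
  holds EVERYWHERE with `c = ξ′`: the inertial representative `V(t, y) = u(t, y + ξ t) − ξ′(t)` is
  bounded, jointly continuous, weakly divergence free, and KNSS/Oseen-mild between all pairs of
  negative times. (a.e. ⇒ everywhere by continuity; `c(t) = u(t, ξ t) − V(t, 0)` is continuous, so
  `ξ ∈ C¹` with `ξ′ = c` by the fundamental theorem of calculus; then bootstrap `C^n ⇒ C^{n+1}`
  through `ξ′ = u(·, ξ ·) − V(·, 0)`, `V` being jointly smooth by KNSS 2009 Prop. 4.1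
  (`contDiffOn_of_bounded_oseenMild`).)
* Consequences for the pressure gauge (the «sublinear pressure ⟺ inertial frame» equivalence made
  unconditional for classical members, and «sublinear gauge = print's class») are in the companion
  file `ThreadingFluxHorizonTowerSublinearGaugeMild`.

The junk values of `u` on `t ≥ 0` are irrelevant: the proof truncates them
(`IsBoundedAncientMildSolution.congr_ae_slice`, `ContinuousOn.measurable_piecewise`), so no
measurability hypothesis is needed.

## References

* G. Koch, N. Nadirashvili, G. Seregin, V. Šverák, *Liouville theorems for the Navier–Stokes
  equations and applications*, Acta Math. 203 (2009) 83–105 = arXiv:0709.3599, §1 p. 3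
  (parasitic solutions `b(t)` and the accelerated frames `y = x − ∫ b`), Lemma 3.1, Prop. 4.1,
  §4 (i)–(ii). [KochNadirashviliSereginSverak2009]
* G. Seregin, *Lecture Notes on Regularity Theory for the Navier–Stokes Equations*, World
  Scientific 2014, §6.3 Def. 6.3, Lemma 6.5 (mild bounded ancient solutions and their pressure).
  [Seregin2014]

WHAT THIS IS NOT: not a claim about NS regularity, the Liouville conjecture (L), or ⟨1222⟩.
-/

-- the summit and its single problem share the name (D-0017 nested layout)
set_option linter.dupNamespace false

noncomputable section

open MeasureTheory Filter Set Function Metric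
open scoped Topology ENNReal ContDiff RealInnerProductSpace

namespace Summit.NavierStokesRegularity.NavierStokesRegularity.Theorems

namespace TypeIliouvilleL.InertialGauge

open Literature.Analysis Literature.Analysis.FluidPDE

/-! ### Truncation of the junk values on `t ≥ 0` -/

/-- The truncation `1_{t<0} u` of a field which is jointly continuous on the open slab
`(−∞,0) × ℝ³` is jointly (strongly) measurable on `ℝ × ℝ³`. -/
theorem stronglyMeasurable_truncate
    {u : ℝ → EuclideanSpace ℝ (Fin 3) → EuclideanSpace ℝ (Fin 3)}
    (hc : ContinuousOn (uncurry u) (Iio 0 ×ˢ univ)) :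
    StronglyMeasurable (uncurry fun t x =>
      (Iio (0 : ℝ) ×ˢ (univ : Set (EuclideanSpace ℝ (Fin 3)))).piecewise (uncurry u) 0 (t, x)) := by
  have h : Measurable ((Iio (0 : ℝ) ×ˢ (univ : Set (EuclideanSpace ℝ (Fin 3)))).piecewise
      (uncurry u) 0) :=
    hc.measurable_piecewise continuousOn_const (measurableSet_Iio.prod MeasurableSet.univ)
  exact h.stronglyMeasurable

/-- The truncation agrees with `u` on every negative slice. -/
theorem truncate_apply_of_neg
    (u : ℝ → EuclideanSpace ℝ (Fin 3) → EuclideanSpace ℝ (Fin 3)) {t : ℝ} (ht : t < 0)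
    (x : EuclideanSpace ℝ (Fin 3)) :
    (Iio (0 : ℝ) ×ˢ (univ : Set (EuclideanSpace ℝ (Fin 3)))).piecewise (uncurry u) 0 (t, x) =
      u t x :=
  piecewise_eq_of_mem _ _ _ (mk_mem_prod ht (mem_univ x))

/-- The truncation of a member of the duality-form class is a member (the class only sees the
negative slices, `IsBoundedAncientMildSolution.congr_ae_slice`). -/
theorem isBoundedAncientMildSolution_truncate
    {u : ℝ → EuclideanSpace ℝ (Fin 3) → EuclideanSpace ℝ (Fin 3)}
    (hu : IsBoundedAncientMildSolution 1 u) :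
    IsBoundedAncientMildSolution 1 fun t x =>
      (Iio (0 : ℝ) ×ˢ (univ : Set (EuclideanSpace ℝ (Fin 3)))).piecewise (uncurry u) 0 (t, x) := by
  refine hu.congr_ae_slice (fun t ht => Eventually.of_forall fun x => truncate_apply_of_neg u ht x) ?_
  obtain ⟨C, hC⟩ := hu.2
  refine ⟨C, fun t ht x => ?_⟩
  show ‖(Iio (0 : ℝ) ×ˢ (univ : Set (EuclideanSpace ℝ (Fin 3)))).piecewise (uncurry u) 0 (t, x)‖ ≤ C
  rw [truncate_apply_of_neg u ht x]
  exact hC t ht x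

/-! ### Joint smoothness of the gauge field on the whole slab -/

/-- A bounded, jointly continuous, weakly divergence-free ancient solution of the Oseen integral
equation is jointly `C^∞` on `(−∞,0) × ℝ³` (KNSS 2009 Prop. 4.1 on every window,
`contDiffOn_of_bounded_oseenMild`; smoothness is local). -/
theorem contDiffOn_slab_of_oseenMild
    {V : ℝ → EuclideanSpace ℝ (Fin 3) → EuclideanSpace ℝ (Fin 3)} {K : ℝ}
    (hVc : ContinuousOn (uncurry V) (Iio 0 ×ˢ univ))
    (hK : ∀ t < 0, ∀ x, ‖V t x‖ ≤ K)
    (hVdiv : ∀ t < 0, IsWeaklyDivFree (V t))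
    (hVmild : ∀ s t : ℝ, s < t → t < 0 → ∀ x,
      V t x = UnboundedOperators.heatExtension (V s) (t - s) x - oseenDuhamel 1 s V V t x) :
    ContDiffOn ℝ ∞ (uncurry V) (Iio 0 ×ˢ univ) := by
  refine contDiffOn_of_locally_contDiffOn ?_
  rintro ⟨t, x⟩ ⟨ht, -⟩
  have ht0 : t < 0 := ht
  refine ⟨Ioo (t - 1) 0 ×ˢ univ, isOpen_Ioo.prod isOpen_univ,
    ⟨⟨by linarith, ht0⟩, mem_univ _⟩, ?_⟩
  have hsub : Ioo (t - 1) 0 ×ˢ (univ : Set (EuclideanSpace ℝ (Fin 3))) ⊆ Iio 0 ×ˢ univ :=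
    prod_mono (fun τ hτ => hτ.2) Subset.rfl
  have h := contDiffOn_of_bounded_oseenMild (A := t - 1) (M := K) (u := V) (hVc.mono hsub)
    (fun τ hτ => hVdiv τ hτ.2) (fun s τ _ hsτ hτ x => hVmild s τ hsτ hτ x)
    (fun τ hτ x => hK τ hτ.2 x)
  exact h.mono inter_subset_right

/-! ### The frame path is `C¹` -/

/-- **FTC for the frame path.** If `A(t) − A(s) = ∫ₛᵗ c` for all `s < t < 0` with `c` interval
integrable and continuous on `(−∞, 0)`, then `A` has derivative `c(t)` at every `t < 0`. -/
theorem hasDerivAt_framePath {A c : ℝ → EuclideanSpace ℝ (Fin 3)}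
    (hint : ∀ s t : ℝ, s < t → t < 0 →
      IntervalIntegrable c volume s t ∧ A t - A s = ∫ τ in s..t, c τ)
    (hcc : ContinuousOn c (Iio 0)) {t : ℝ} (ht : t < 0) :
    HasDerivAt A (c t) t := by
  -- `A = A(t − 1) + ∫_{t−1} c` near `t`
  have hF : HasDerivAt (fun τ => ∫ σ in (t - 1)..τ, c σ) (c t) t :=
    intervalIntegral.integral_hasDerivAt_right (hint (t - 1) t (by linarith) ht).1
      (hcc.stronglyMeasurableAtFilter isOpen_Iio t ht) (hcc.continuousAt (Iio_mem_nhds ht))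
  have hev : A =ᶠ[𝓝 t] fun τ => A (t - 1) + ∫ σ in (t - 1)..τ, c σ := by
    filter_upwards [Ioo_mem_nhds (show t - 1 < t by linarith) ht] with τ hτ
    rw [← (hint (t - 1) τ hτ.1 hτ.2).2]
    abel
  exact ((hF.const_add (A (t - 1))).congr_of_eventuallyEq hev)

end TypeIliouvilleL.InertialGauge

open TypeIliouvilleL.InertialGauge Literature.Analysis Literature.Analysis.FluidPDE in
/-- ★ **DRIFT REGULARITY / THE INERTIAL GAUGE OF A SMOOTH MEMBER OF THE DUALITY-FORM CLASS.**
Let `u` be a bounded ancient mild solution of Navier–Stokes in duality form (`ν = 1`) which is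
jointly `C^∞` on the open slab `(−∞,0) × ℝ³` (the class of the W1 crux `PoloidalLiouville`; the
values of `u` on `t ≥ 0` are irrelevant). Then there is a frame path `ξ`, `C^∞` on `t < 0`, such
that the INERTIAL REPRESENTATIVE `V(t, y) = u(t, y + ξ(t)) − ξ′(t)` is uniformly bounded, jointly
continuous and weakly divergence free on `(−∞,0) × ℝ³`, and solves the Oseen integral (KNSS-mild)
equation `V(t) = e^{(t−s)Δ}V(s) − B¹ₛ(V,V)(t)` pointwise for all `s < t < 0` — i.e. `u` is the
image of a bounded ancient mild solution of print's class (KNSS 2009 §4 (i)) under the accelerated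
Galilean frame `x = y + ξ(t)` (KNSS 2009 §1 p. 3). Proof: Oseen gauge with the drift path
exported (`oseen_gauge_driftPath_of_stronglyMeasurable` on the truncation `1_{t<0} u`), a.e. ⇒
everywhere by continuity, `ξ′ = c` by the fundamental theorem of calculus
(`hasDerivAt_framePath`), and the bootstrap `ξ ∈ C^n ⇒ ξ′ = u(·, ξ ·) − V(·, 0) ∈ C^n` with `V`
jointly smooth (`contDiffOn_slab_of_oseenMild`, KNSS Prop. 4.1). -/
theorem inertialGauge_of_smooth
    (u : ℝ → EuclideanSpace ℝ (Fin 3) → EuclideanSpace ℝ (Fin 3))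
    (hu : Literature.Analysis.FluidPDE.IsBoundedAncientMildSolution 1 u)
    (hsm : ContDiffOn ℝ (⊤ : ℕ∞) (Function.uncurry u) (Set.Iio 0 ×ˢ Set.univ)) :
    ∃ ξ : ℝ → EuclideanSpace ℝ (Fin 3), ContDiffOn ℝ ∞ ξ (Set.Iio 0) ∧
      ∃ M : ℝ, (∀ t < 0, ∀ y, ‖u t (y + ξ t) - deriv ξ t‖ ≤ M) ∧
        ContinuousOn (Function.uncurry fun t y => u t (y + ξ t) - deriv ξ t)
          (Set.Iio 0 ×ˢ Set.univ) ∧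
        (∀ t < 0, Literature.Analysis.FluidPDE.IsWeaklyDivFree fun y => u t (y + ξ t) - deriv ξ t) ∧
        ∀ s t : ℝ, s < t → t < 0 → ∀ y, u t (y + ξ t) - deriv ξ t =
          Literature.Analysis.UnboundedOperators.heatExtension
              (fun z => u s (z + ξ s) - deriv ξ s) (t - s) y -
            Literature.Analysis.FluidPDE.oseenDuhamel 1 s (fun τ z => u τ (z + ξ τ) - deriv ξ τ)
              (fun τ z => u τ (z + ξ τ) - deriv ξ τ) t y := by
  have hcu : ContinuousOn (uncurry u) (Iio 0 ×ˢ univ) := hsm.continuousOn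
  -- ## the truncation and its Oseen gauge with the drift path exported
  set u₀ : ℝ → EuclideanSpace ℝ (Fin 3) → EuclideanSpace ℝ (Fin 3) := fun t x =>
    (Iio (0 : ℝ) ×ˢ (univ : Set (EuclideanSpace ℝ (Fin 3)))).piecewise (uncurry u) 0 (t, x)
    with hu₀_def
  have hu₀ : IsBoundedAncientMildSolution 1 u₀ := isBoundedAncientMildSolution_truncate hu
  have hj₀ : StronglyMeasurable (uncurry u₀) := stronglyMeasurable_truncate hcu
  obtain ⟨V, A, c, -, hVc, ⟨K, hK⟩, hVdiv, hVmild, hAc, hrep, hAint⟩ :=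
    oseen_gauge_driftPath_of_stronglyMeasurable u₀ hu₀ hj₀
  -- slices
  have hVsl : ∀ t < 0, Continuous (V t) := fun t ht =>
    hVc.comp_continuous (Continuous.prodMk_right t) fun y => ⟨ht, mem_univ y⟩
  have husl : ∀ t < 0, Continuous (u t) := fun t ht =>
    hcu.comp_continuous (Continuous.prodMk_right t) fun y => ⟨ht, mem_univ y⟩
  -- ## a.e. ⇒ everywhere
  have hrepx : ∀ t < 0, ∀ x, u t x = V t (x - A t) + c t := by
    intro t ht
    have hae : u t =ᵐ[volume] fun x => V t (x - A t) + c t := by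
      have h1 : u₀ t = u t := funext fun x => truncate_apply_of_neg u ht x
      rw [← h1]
      exact hrep t ht
    have hW : Continuous fun x => V t (x - A t) + c t :=
      ((hVsl t ht).comp (continuous_id.sub continuous_const)).add continuous_const
    have heq := (Continuous.ae_eq_iff_eq volume (husl t ht) hW).1 hae
    exact fun x => congrFun heq x
  -- the inertial representative IS the gauge field
  have hVrep : ∀ t < 0, ∀ y, u t (y + A t) - c t = V t y := by
    intro t ht y
    rw [hrepx t ht, add_sub_cancel_right, add_sub_cancel_right]
  -- ## `c` is continuous on `t < 0`: `c t = u t (A t) − V t 0`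
  have hcA : ∀ t < 0, c t = u t (A t) - V t 0 := by
    intro t ht
    rw [hrepx t ht, sub_self]
    abel
  have hmaps : MapsTo (fun t : ℝ => (t, A t)) (Iio 0)
      (Iio (0 : ℝ) ×ˢ (univ : Set (EuclideanSpace ℝ (Fin 3)))) :=
    fun t ht => ⟨ht, mem_univ _⟩
  have hmaps0 : MapsTo (fun t : ℝ => (t, (0 : EuclideanSpace ℝ (Fin 3)))) (Iio 0)
      (Iio (0 : ℝ) ×ˢ (univ : Set (EuclideanSpace ℝ (Fin 3)))) :=
    fun t ht => ⟨ht, mem_univ _⟩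
  have hcc : ContinuousOn c (Iio 0) := by
    have h1 : ContinuousOn (fun t => u t (A t)) (Iio 0) :=
      hcu.comp (continuous_id.prodMk hAc).continuousOn hmaps
    have h2 : ContinuousOn (fun t => V t 0) (Iio 0) :=
      hVc.comp (continuous_id.prodMk continuous_const).continuousOn hmaps0
    exact (h1.sub h2).congr fun t ht => hcA t ht
  -- ## `A ∈ C¹`, `A′ = c`
  have hder : ∀ t < 0, HasDerivAt A (c t) t := fun t ht => hasDerivAt_framePath hAint hcc ht
  have hderiv : ∀ t < 0, deriv A t = c t := fun t ht => (hder t ht).deriv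
  have hdiff : DifferentiableOn ℝ A (Iio 0) := fun t ht =>
    (hder t ht).differentiableAt.differentiableWithinAt
  -- ## bootstrap: `A ∈ C^n` for every `n`
  have hVsm : ContDiffOn ℝ ∞ (uncurry V) (Iio 0 ×ˢ univ) :=
    contDiffOn_slab_of_oseenMild hVc hK hVdiv hVmild
  have hAn : ∀ n : ℕ, ContDiffOn ℝ n A (Iio 0) := by
    intro n
    induction n with
    | zero => exact contDiffOn_zero.2 hAc.continuousOn
    | succ n ih =>
      rw [show ((n + 1 : ℕ) : WithTop ℕ∞) = (n : WithTop ℕ∞) + 1 by push_cast; rfl,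
        contDiffOn_succ_iff_deriv_of_isOpen isOpen_Iio]
      refine ⟨hdiff, fun h => absurd h (by simp), ?_⟩
      have h1 : ContDiffOn ℝ n (fun t => u t (A t)) (Iio 0) :=
        (hsm.of_le (by exact_mod_cast le_top)).comp (contDiffOn_id.prodMk ih) hmaps
      have h2 : ContDiffOn ℝ n (fun t => V t (0 : EuclideanSpace ℝ (Fin 3))) (Iio 0) :=
        (hVsm.of_le (by exact_mod_cast le_top)).comp
          (contDiffOn_id.prodMk contDiffOn_const) hmaps0
      exact (h1.sub h2).congr fun t ht => (hderiv t ht).trans (hcA t ht)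
  have hAsm : ContDiffOn ℝ ∞ A (Iio 0) := contDiffOn_infty.2 hAn
  -- ## conclusion with `ξ := A`
  refine ⟨A, hAsm, K, fun t ht y => ?_, ?_, fun t ht => ?_, fun s t hst ht y => ?_⟩
  · rw [hderiv t ht, hVrep t ht y]
    exact hK t ht y
  · refine hVc.congr ?_
    rintro ⟨t, y⟩ ⟨ht, -⟩
    simp only [uncurry_apply_pair]
    rw [hderiv t ht, hVrep t ht y]
  · have h : (fun y => u t (y + A t) - deriv A t) = V t := funext fun y => by
      rw [hderiv t ht, hVrep t ht y]
    rw [h]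
    exact hVdiv t ht
  · have hs : s < 0 := hst.trans ht
    have hVs : (fun z => u s (z + A s) - deriv A s) = V s := funext fun z => by
      rw [hderiv s hs, hVrep s hs z]
    have hVτ : ∀ τ ∈ Ioo s t, (fun τ z => u τ (z + A τ) - deriv A τ) τ = V τ := fun τ hτ =>
      funext fun z => by
        have hτ0 : τ < 0 := hτ.2.trans ht
        simp only
        rw [hderiv τ hτ0, hVrep τ hτ0 z]
    rw [hderiv t ht, hVrep t ht y, hVs, oseenDuhamel_congr_Ioo hVτ hVτ y]
    exact hVmild s t hst ht y

end Summit.NavierStokesRegularity.NavierStokesRegularity.Theorems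

end
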